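import Summits.QuantumFields.YangMills.Theorems.LuscherReductionDressedRitzPolyakovLiftTransplant
import Literature.Analysis.OperatorTheory.YangMillsMatrixModelGroundStateSign
import HarnessLib

/-!
# Route `LuscherReduction`, item `DressedRitz` (stmt-QuantumFields-20205), line «polyakovlift» r6 — THE TRANSPLANT BASIS IS NONVACUOUS

Support theorems (fleet seat prover ym-infvol-p1 g7; `--supports stmt-QuantumFields-20205`; F7 of the LEAD's r6 wave,
`R6-DESIGN.md` §3 «F7 `f_0 > 0`»).  Skeleton r6 of the line keys every stub to the basis predicate
`TransplantBasis k Λ g` (`…PolyakovLiftTransplant.lean`, p551813): `g_i = (χ_R · f_{i+1}/f_0) ∘ expCoord(Λ/2)` for an AL1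
eigenfamily `f` of Lüscher's matrix Hamiltonian `𝔥` WITH A POSITIVE GROUND STATE `f_0 > 0` (one divides by `f_0`).  The
∃-stub S-PSCAL″ (`PScalingExistsFor (TransplantBasis k)`) needs a WITNESS, i.e. that such families exist; the ∀-stubs are
otherwise vacuous.  This file supplies it from the Literature theorem
`Literature.Analysis.OperatorTheory.YMMatrixModel.groundState_pos_or_neg` (the invariant ground state of `𝔥` does not
change sign: core minimizing sequence `χ_Rf_0` + variational Perron–Frobenius + E. Hopf; `YangMillsMatrixModelGroundStateSign.lean`):

* `isEigenFamily_groundState_sign` — for EVERY AL1 eigenfamily (`IsEigenFamily k f`), `f_0 > 0` everywhere or `f_0 < 0` everywhere;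
* `exists_isEigenFamily_pos_of_isEigenFamily` — sign normalisation: `f' = (±f_0, f_1, …, f_k)` is an AL1 eigenfamily with `f'_0 > 0`;
* ★ `exists_isEigenFamily_pos` — for every `k` an AL1 eigenfamily with `f_0 > 0` exists;
* ★ `transplantBasis_nonempty` — **`Λ ≤ 1/4 → ∃ g, TransplantBasis k Λ g`** (radius `R = 1`), and `transplantBasis_nonempty_of_radius`
  for any admissible radius `1 ≤ R ≤ 1/(4Λ)` (so the pinned-radius variants of the cdisprove R6 PRE-VET are covered too).

HONEST FRAMING: spectral theory of the 9-dimensional matrix model serving the witness of ONE stub of a CONDITIONAL crux on the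
femto rung R2b1; no stub is closed here; nothing bears on infinite volume, the continuum limit or the Clay gap.
References: Reed–Simon IV [cite: ReedSimonIV1978, Thm. XIII.47–48]; Lieb–Loss [cite: LiebLoss2001, Thm. 11.8];
M. Lüscher, NPB 219 (1983) 233 [cite: Luscher1983, §2–§3].
-/

set_option autoImplicit false

noncomputable section

open MeasureTheory
open Literature.Analysis.OperatorTheory.YMMatrixModel

namespace Summit.QuantumFields.YangMills.Theorems.FemtoTransferGap.PolyakovLift

open Summit.QuantumFields.YangMills.Theorems.FemtoTransferGap

variable {k : ℕ}

/-- For every AL1 eigenfamily the ground state `f_0` is everywhere `> 0` or everywhere `< 0`.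
[cite: ReedSimonIV1978, Thm. XIII.47–48] [cite: LiebLoss2001, Thm. 11.8] -/
theorem isEigenFamily_groundState_sign {f : Fin (k + 1) → ZM → ℝ} (hf : IsEigenFamily k f) :
    (∀ x, 0 < f 0 x) ∨ (∀ x, f 0 x < 0) :=
  groundState_sign_of_clauses hf.1 hf.2.1 hf.2.2.1 hf.2.2.2.1 hf.2.2.2.2

/-- Sign normalisation: every AL1 eigenfamily `f` has a companion AL1 eigenfamily `f'` with `f'_0 > 0`, `f'_j = f_j` (`j ≠ 0`)
and `f'_0 = ±f_0`. [cite: ReedSimonIV1978, Thm. XIII.47–48] -/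
theorem exists_isEigenFamily_pos_of_isEigenFamily {f : Fin (k + 1) → ZM → ℝ} (hf : IsEigenFamily k f) :
    ∃ f' : Fin (k + 1) → ZM → ℝ, IsEigenFamily k f' ∧ (∀ x, 0 < f' 0 x) ∧ (∀ j, j ≠ 0 → f' j = f j) ∧
      (f' 0 = f 0 ∨ f' 0 = -f 0) := by
  obtain ⟨f', h1, h2, h3, h4, h5, hpos, hsame, hflip⟩ :=
    exists_pos_groundState_of_clauses hf.1 hf.2.1 hf.2.2.1 hf.2.2.2.1 hf.2.2.2.2
  exact ⟨f', ⟨h1, h2, h3, h4, h5⟩, hpos, hsame, hflip⟩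

/-- ★ For every `k` there is an AL1 eigenfamily `f_0, …, f_k` of Lüscher's `𝔥` with STRICTLY POSITIVE ground state.
[cite: ReedSimonIV1978, Thm. XIII.47–48, Thm. XIII.64] -/
theorem exists_isEigenFamily_pos (k : ℕ) : ∃ f : Fin (k + 1) → ZM → ℝ, IsEigenFamily k f ∧ ∀ x, 0 < f 0 x := by
  obtain ⟨f, h1, h2, h3, h4, h5, hpos⟩ := exists_eigenfunctions_pos_groundState k
  exact ⟨f, ⟨h1, h2, h3, h4, h5⟩, hpos⟩

/-- ★ **The r6 basis predicate is nonvacuous at any admissible radius**: for `1 ≤ R` and `R·Λ ≤ 1/4` there is a transplant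
basis `g` with `TransplantBasis k Λ g`, namely `g_i = transplantObs Λ R f i` for an AL1 eigenfamily with `f_0 > 0`.
[cite: Luscher1983, §2–§3] [cite: ReedSimonIV1978, Thm. XIII.47–48] -/
theorem transplantBasis_nonempty_of_radius (k : ℕ) {Λ R : ℝ} (hR : 1 ≤ R) (hRΛ : R * Λ ≤ 1 / 4) :
    ∃ g : Fin k → (Cfg → ℝ), TransplantBasis k Λ g ∧
      ∃ f : Fin (k + 1) → ZM → ℝ, IsEigenFamily k f ∧ (∀ x, 0 < f 0 x) ∧ ∀ i, g i = transplantObs Λ R f i := by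
  obtain ⟨f, hf, hpos⟩ := exists_isEigenFamily_pos k
  exact ⟨fun i => transplantObs Λ R f i, ⟨f, R, hf, hpos, hR, hRΛ, fun _ => rfl⟩, f, hf, hpos, fun _ => rfl⟩

/-- ★ **`TransplantBasis k Λ` is nonvacuous for `Λ ≤ 1/4`** (radius `R = 1`): the ∃-stub S-PSCAL″ of skeleton r6 has
candidates, and the ∀-stubs are not vacuous. [cite: Luscher1983, §2–§3] [cite: ReedSimonIV1978, Thm. XIII.47–48] -/
theorem transplantBasis_nonempty (k : ℕ) {Λ : ℝ} (hΛ : Λ ≤ 1 / 4) : ∃ g : Fin k → (Cfg → ℝ), TransplantBasis k Λ g := by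
  have h1 : (1 : ℝ) * Λ ≤ 1 / 4 := by rw [one_mul]; exact hΛ
  obtain ⟨g, hg, -⟩ := transplantBasis_nonempty_of_radius k (Λ := Λ) (R := 1) le_rfl h1
  exact ⟨g, hg⟩

end Summit.QuantumFields.YangMills.Theorems.FemtoTransferGap.PolyakovLift

end
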